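import Summits.ValiantsHypothesis.ValiantsHypothesis.Theorems.TwoProducts.RankThreeWronskianTowerArcs

/-!
# Rank three, part R3c-2 (`TowerKernel3`, R3): line-specials and the ONE-OPERATOR TOWER on an arc

`Ef` (edges of `G` on arc `b`), `Spec3` (the line-special ones), `special_tie3`, `special_line_top`, `lam_eq_lam`, ★ `linePoint_eq` (two line-specials on one arc
share their on-line top point), ★ `spec3_le_two` (≤ 2 line-specials per chart-arc and level), `support_pderiv_deg3`, `deg2_lt_of_totalDegree`, and — in `section ArcTower`
with the arc data `(w', p₀, p₁)` — ★ `step3` (one level: an edge normal on the arc is line-special, or an edge normal of `Ω(w')`, or one of `(∂₂Q)(w')`;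
= ✓ `wronskianTransfer` + ✓ `wronskianRule` + ✓ `ostrowski`) and ★★ `tower3` (`|Ef_b(Q(w'))| ≤ n·(2 + |Eset σ Ω(w')|)` for `deg_{X₂} Q < n`).

Port (val-port-4 g4, desk RULING #498 (A)/#499; critic of record val-idea-crit-8 g4, VERDICT #47 «R3c PORT LICENCE») of `section TowerKernel3` (R3) of
val-idea-35 g10's crux workfile `Cruxes/TwoProducts/RankThreeWronskian_val_idea_35_g10.lean` REV 2 @1064d0978540 (sha16 d29beed995ebec39, 2064 l., farm rc 0 / 0 sorry / std axioms) — bodies VERBATIM, namespace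
`…Cruxes.TwoProducts.ValIdea35g10` → `…Theorems.TwoProducts.RankTwoJacobian`; imports part R3c-1 (`…RankThreeWronskianTowerArcs`); lint docstrings added to 6 helpers.
HONEST LABEL: helper/instance theorems for the SIDE ladder «table-rank-ladder» (K13, rung 3-LIN) of crux `stmt-ValiantsHypothesis-5906` (`TwoProducts`):
a class-(3,·) law with a crude constant; NOT γ; `RankThreeExplicitBound` (the sharp `t³ + 9t²(4m+1)`) and `PortPlan3` stay PAPER in the workfile and are NOT
ported; nothing closes 5906 / `PlanarCellBound` / `ResidualLawV25`; 0 distance on the crux; VP ≠ VNP is NOT proved.  `--supports stmt-ValiantsHypothesis-5906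
--as helper`.  Credit: val-idea-35 g10 (crit-8 g4 VERDICT #47 ★★).  No instances, no notation, no named facts. [folklore]
-/

noncomputable section
set_option linter.dupNamespace false

namespace Summit.ValiantsHypothesis.ValiantsHypothesis.Theorems.TwoProducts.RankTwoJacobian

open scoped BigOperators Pointwise Classical
open MvPolynomial

/-! ### Rank 3 — R3: line-specials, and the tower on an arc -/

/-- edge-normal chart values of `G` lying on arc `b` -/
def Ef (σ : ℝ) (w : Fin 3 → Poly2) (b : ℕ) (G : Poly2) : Finset ℝ := (Eset σ G).filter (fun μ => OnArc σ w b μ)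

/-- membership in the arc-restricted edge set `Ef`. -/
theorem mem_Ef {σ : ℝ} (hσ : σ = 1 ∨ σ = -1) {w : Fin 3 → Poly2} {b : ℕ} {G : Poly2} {μ : ℝ} :
    μ ∈ Ef σ w b G ↔ IsEdgeDir (dir σ μ) G ∧ OnArc σ w b μ := by
  unfold Ef; rw [Finset.mem_filter, mem_Eset hσ]

/-- `Ef ⊆ Eset`. -/
theorem Ef_subset_Eset (σ : ℝ) (w : Fin 3 → Poly2) (b : ℕ) (G : Poly2) : Ef σ w b G ⊆ Eset σ G :=
  Finset.filter_subset _ _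

/-- the zero polynomial has no edges on any arc. -/
theorem Ef_zero (σ : ℝ) (w : Fin 3 → Poly2) (b : ℕ) : Ef σ w b 0 = ∅ := by
  unfold Ef; rw [Eset_zero]; simp

/-- line-specials of `F` for the line datum `(k, p₀, p₁)`, on arc `b` -/
def Spec3 (σ : ℝ) (w : Fin 3 → Poly2) (b : ℕ) (F : Poly2) (k : ℕ) (p₀ p₁ : Expo) : Finset ℝ :=
  (Ef σ w b F).filter (fun μ => IsLineSpecial (dir σ μ) F k p₀ p₁)

/-- a line-special direction is in particular an edge direction (a tie). -/
theorem special_tie3 {ν : Fin 2 → ℝ} {F : Poly2} {k : ℕ} {p₀ p₁ : Expo} (h : IsLineSpecial ν F k p₀ p₁) :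
    TieIn ν F.support := by
  obtain ⟨p, hp, q, hq, hpq, hptop, hqp, -, -⟩ := h
  exact ⟨p, hp, q, hq, hpq, hptop, hqp⟩

/-- a line-special direction has a top point ON the line -/
theorem special_line_top {ν : Fin 2 → ℝ} {F : Poly2} {k : ℕ} {p₀ p₁ : Expo} (h : IsLineSpecial ν F k p₀ p₁) :
    ∃ a ∈ F.support, lam k p₀ p₁ a = 0 ∧ ∀ r ∈ F.support, wt ν r ≤ wt ν a := by
  obtain ⟨p, hp, q, hq, _, hptop, hqp, -, hl⟩ := h
  rcases hl with h | h
  · exact ⟨p, hp, h, hptop⟩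
  · exact ⟨q, hq, h, fun r hr => (hptop r hr).trans_eq hqp.symm⟩

/-- `lam k p₀ p₁` is affine with gradient `⊥ (p₀ − p₁)`: equal values ⇒ the difference is parallel to `p₀ − p₁` -/
theorem lam_eq_lam {k : ℕ} {p₀ p₁ a a' : Expo} (h : lam k p₀ p₁ a = lam k p₀ p₁ a') :
    (((a 0 : ℕ) : ℤ) - ((a' 0 : ℕ) : ℤ)) * (((p₀ 1 : ℕ) : ℤ) - ((p₁ 1 : ℕ) : ℤ))
      = (((a 1 : ℕ) : ℤ) - ((a' 1 : ℕ) : ℤ)) * (((p₀ 0 : ℕ) : ℤ) - ((p₁ 0 : ℕ) : ℤ)) := by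
  unfold lam idet at h
  linear_combination h

set_option maxHeartbeats 400000 in
/-- LINE-POINT CONSTANCY: two line-specials on one arc share their on-line top point -/
theorem linePoint_eq {σ : ℝ} (hσ : σ = 1 ∨ σ = -1) {w : Fin 3 → Poly2} {b : ℕ} {x y : ℝ} (_hxy : x < y)
    (hx : OnArc σ w b x) (hy : OnArc σ w b y) {p₀ p₁ : Expo} (hp₀ : p₀ ∈ S3 w) (hp₁ : p₁ ∈ S3 w) (hne : p₀ ≠ p₁)
    {k : ℕ} {F : Poly2} {a a' : Expo} (ha : lam k p₀ p₁ a = 0) (ha' : lam k p₀ p₁ a' = 0)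
    (haS : a ∈ F.support) (ha'S : a' ∈ F.support)
    (hatop : ∀ r ∈ F.support, wt (dir σ x) r ≤ wt (dir σ x) a)
    (ha'top : ∀ r ∈ F.support, wt (dir σ y) r ≤ wt (dir σ y) a') : a = a' := by
  have hpar := lam_eq_lam (ha.trans ha'.symm)
  have hparR : (((a 0 : ℕ) : ℝ) - ((a' 0 : ℕ) : ℝ)) * (((p₀ 1 : ℕ) : ℝ) - ((p₁ 1 : ℕ) : ℝ))
      = (((a 1 : ℕ) : ℝ) - ((a' 1 : ℕ) : ℝ)) * (((p₀ 0 : ℕ) : ℝ) - ((p₁ 0 : ℕ) : ℝ)) := by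
    exact_mod_cast hpar
  have i1 := hatop a' ha'S
  have i2 := ha'top a haS
  have gx : wt (dir σ x) p₀ - wt (dir σ x) p₁ ≠ 0 := sub_ne_zero.mpr (wt_ne3 hσ hx.1 hp₀ hp₁ hne)
  have gy : wt (dir σ y) p₀ - wt (dir σ y) p₁ ≠ 0 := sub_ne_zero.mpr (wt_ne3 hσ hy.1 hp₀ hp₁ hne)
  have hs := sameSign3 hσ hx hy hp₀ hp₁
  have ex := wt_sub_eq σ x a a'
  have ey := wt_sub_eq σ y a a'
  have gxe := wt_sub_eq σ x p₀ p₁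
  have gye := wt_sub_eq σ y p₀ p₁
  set A := wt (dir σ x) a - wt (dir σ x) a' with hA
  set B := wt (dir σ y) a - wt (dir σ y) a' with hB
  set gX := wt (dir σ x) p₀ - wt (dir σ x) p₁ with hgX
  set gY := wt (dir σ y) p₀ - wt (dir σ y) p₁ with hgY
  set Δ0 := ((a 0 : ℕ) : ℝ) - ((a' 0 : ℕ) : ℝ) with hΔ0
  set Δ1 := ((a 1 : ℕ) : ℝ) - ((a' 1 : ℕ) : ℝ) with hΔ1
  set d0 := ((p₀ 0 : ℕ) : ℝ) - ((p₁ 0 : ℕ) : ℝ) with hd0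
  set d1 := ((p₀ 1 : ℕ) : ℝ) - ((p₁ 1 : ℕ) : ℝ) with hd1
  have hA0 : 0 ≤ A := by rw [hA]; linarith
  have hB0 : B ≤ 0 := by rw [hB]; linarith
  have hgpos : 0 < gX * gY := by
    rcases lt_or_gt_of_ne gx with h | h
    · have h' : gY < 0 := by
        rcases lt_or_gt_of_ne gy with h2 | h2
        · exact h2
        · exact absurd (hs.mpr h2) (not_lt.mpr h.le)
      exact mul_pos_of_neg_of_neg h h'
    · exact mul_pos h (hs.mp h)
  have key1 : Δ0 * gX = d0 * A := by rw [ex, gxe]; linear_combination σ * hparR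
  have key2 : Δ0 * gY = d0 * B := by rw [ey, gye]; linear_combination σ * hparR
  have hsq : Δ0 ^ 2 * (gX * gY) = d0 ^ 2 * (A * B) := by
    calc Δ0 ^ 2 * (gX * gY) = (Δ0 * gX) * (Δ0 * gY) := by ring
      _ = (d0 * A) * (d0 * B) := by rw [key1, key2]
      _ = d0 ^ 2 * (A * B) := by ring
  have hΔ0z : Δ0 = 0 := by
    by_contra hne0
    have h0 : 0 < Δ0 ^ 2 := lt_of_le_of_ne (sq_nonneg Δ0) (Ne.symm (pow_ne_zero 2 hne0))
    have h1 : 0 < Δ0 ^ 2 * (gX * gY) := mul_pos h0 hgpos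
    have h2' : 0 ≤ d0 ^ 2 * A := mul_nonneg (sq_nonneg d0) hA0
    have h2 : d0 ^ 2 * (A * B) ≤ 0 := by nlinarith [h2', hB0]
    linarith
  have hΔ1z : Δ1 = 0 := by
    have e1 : A = σ * Δ1 := by rw [ex, hΔ0z]; ring
    have e2 : B = σ * Δ1 := by rw [ey, hΔ0z]; ring
    have : σ * Δ1 = 0 := by linarith
    rcases mul_eq_zero.mp this with h | h
    · exact absurd h (sigma_ne_zero hσ)
    · exact h
  apply expo_eq_of_coords
  · have : ((a 0 : ℕ) : ℝ) = ((a' 0 : ℕ) : ℝ) := by linarith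
    exact_mod_cast this
  · have : ((a 1 : ℕ) : ℝ) = ((a' 1 : ℕ) : ℝ) := by linarith
    exact_mod_cast this

/-- AT MOST TWO line-specials per (chart-arc, level) -/
theorem spec3_le_two {σ : ℝ} (hσ : σ = 1 ∨ σ = -1) (w : Fin 3 → Poly2) (b : ℕ) (F : Poly2) (k : ℕ) {p₀ p₁ : Expo}
    (hp₀ : p₀ ∈ S3 w) (hp₁ : p₁ ∈ S3 w) (hne : p₀ ≠ p₁) : (Spec3 σ w b F k p₀ p₁).card ≤ 2 := by
  by_contra h3; push Not at h3
  set f := Spec3 σ w b F k p₀ p₁ with hf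
  have hne' : f.Nonempty := Finset.card_pos.mp (by omega)
  set x := f.min' hne' with hx
  set y := f.max' hne' with hy
  have hxf : x ∈ f := Finset.min'_mem f hne'
  have hyf : y ∈ f := Finset.max'_mem f hne'
  have hcard : ((f.erase x).erase y).card ≥ 1 := by
    have h1 := Finset.card_erase_of_mem hxf
    have h2 : ((f.erase x).erase y).card ≥ (f.erase x).card - 1 := by
      by_cases hy' : y ∈ f.erase x
      · rw [Finset.card_erase_of_mem hy']
      · rw [Finset.erase_eq_of_notMem hy']; omega
    omega
  obtain ⟨m, hm⟩ := Finset.card_pos.mp (by omega : 0 < ((f.erase x).erase y).card)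
  have hmy : m ≠ y := Finset.ne_of_mem_erase hm
  have hm' := Finset.mem_of_mem_erase hm
  have hmx : m ≠ x := Finset.ne_of_mem_erase hm'
  have hmf : m ∈ f := Finset.mem_of_mem_erase hm'
  have hxm : x < m := lt_of_le_of_ne (Finset.min'_le f m hmf) (Ne.symm hmx)
  have hmy' : m < y := lt_of_le_of_ne (Finset.le_max' f m hmf) hmy
  have unpack : ∀ u ∈ f, OnArc σ w b u ∧ IsLineSpecial (dir σ u) F k p₀ p₁ := by
    intro u hu
    obtain ⟨hu1, hu2⟩ := Finset.mem_filter.mp hu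
    exact ⟨((mem_Ef hσ).mp hu1).2, hu2⟩
  obtain ⟨ox, hsx⟩ := unpack x hxf
  obtain ⟨om, hsm⟩ := unpack m hmf
  obtain ⟨oy, hsy⟩ := unpack y hyf
  obtain ⟨ax, haxS, hax, htx⟩ := special_line_top hsx
  obtain ⟨am, hamS, ham, htm⟩ := special_line_top hsm
  obtain ⟨ay, hayS, hay, hty⟩ := special_line_top hsy
  have e1 : ax = am := linePoint_eq hσ hxm ox om hp₀ hp₁ hne hax ham haxS hamS htx htm
  have e2 : am = ay := linePoint_eq hσ hmy' om oy hp₀ hp₁ hne ham hay hamS hayS htm hty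
  subst e1; subst e2
  have hu := utop_between hσ hxm hmy' haxS htx hty
  exact not_tie_of_utop hu (special_tie3 hsm)

/-- `∂₂` lowers the `X₂`-degree of every monomial. -/
theorem support_pderiv_deg3 {Q : Poly3} {s : Fin 3 →₀ ℕ} (hs : s ∈ (pderiv 2 Q).support) :
    s + Finsupp.single 2 1 ∈ Q.support := by
  rw [MvPolynomial.mem_support_iff, coeff_pderiv] at hs
  rw [MvPolynomial.mem_support_iff]
  intro h; apply hs; rw [h, zero_mul]

/-- the `X₂`-degree of a monomial of `P` is below `totalDegree P + 1`. -/
theorem deg2_lt_of_totalDegree (P : Poly3) : ∀ s ∈ P.support, s 2 < P.totalDegree + 1 := by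
  intro s hs
  have h1 : s 2 ≤ s.sum (fun _ e => e) := by
    by_cases h : (2 : Fin 3) ∈ s.support
    · exact Finset.single_le_sum (fun j _ => Nat.zero_le (s j)) h
    · rw [Finsupp.notMem_support_iff.mp h]; exact Nat.zero_le _
  have h2 := le_totalDegree hs
  omega

section ArcTower
variable {σ : ℝ} (hσ : σ = 1 ∨ σ = -1) (w : Fin 3 → Poly2) (b : ℕ) (w' : Fin 3 → Poly2) {p₀ p₁ : Expo}
  (hp₀ : p₀ ∈ S3 w) (hp₁ : p₁ ∈ S3 w) (hne : p₀ ≠ p₁)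
  (htop : ∀ μ, OnArc σ w b μ →
    IsUniqueTop (dir σ μ) (w' 0) p₀ ∧ IsUniqueTop (dir σ μ) (w' 1) p₁ ∧ wt (dir σ μ) p₀ ≠ wt (dir σ μ) p₁)
include hσ htop

/-- ONE LEVEL of the tower: an edge normal on the arc is a line-special, or an edge normal of `Ω(w')`, or an edge
normal of the next level `(∂₂Q)(w')` — `wronskianTransfer` + `wronskianRule` + `ostrowski`. -/
theorem step3 (Q : Poly3) (k : ℕ) (hQ : Q.IsHomogeneous k) :
    Ef σ w b (aeval w' Q) ⊆
      Spec3 σ w b (aeval w' Q) k p₀ p₁ ∪ Ef σ w b (omega w') ∪ Ef σ w b (aeval w' (pderiv 2 Q)) := by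
  intro μ hμ
  obtain ⟨hedge, harc⟩ := (mem_Ef hσ).mp hμ
  obtain ⟨h0, h1, h01⟩ := htop μ harc
  rcases wronskianTransfer (dir σ μ) (aeval w' Q) (w' 0) (w' 1) k p₀ p₁ (ne_zero_of_isEdgeDir hedge) h0 h1 h01
      hedge with hsp | hE
  · exact Finset.mem_union_left _ (Finset.mem_union_left _ (Finset.mem_filter.mpr ⟨hμ, hsp⟩))
  · rw [← wronskianRule w' Q k hQ] at hE
    by_cases hΩ : omega w' = 0
    · exfalso; rw [hΩ, zero_mul] at hE; exact ne_zero_of_isEdgeDir hE rfl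
    by_cases hD : aeval w' (pderiv 2 Q) = 0
    · exfalso; rw [hD, mul_zero] at hE; exact ne_zero_of_isEdgeDir hE rfl
    rcases (ostrowski _ _ _ hΩ hD).mp hE with h | h
    · exact Finset.mem_union_left _ (Finset.mem_union_right _ ((mem_Ef hσ).mpr ⟨h, harc⟩))
    · exact Finset.mem_union_right _ ((mem_Ef hσ).mpr ⟨h, harc⟩)

include hp₀ hp₁ hne in
/-- THE TOWER on an arc: `|Ef_b(Q(w'))| ≤ n · (2 + |Eset σ Ω(w')|)` whenever `deg_{X₂} Q < n`, `Q` homogeneous -/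
theorem tower3 : ∀ (n : ℕ) (Q : Poly3) (k : ℕ), Q.IsHomogeneous k → (∀ s ∈ Q.support, s 2 < n) →
    (Ef σ w b (aeval w' Q)).card ≤ n * (2 + (Eset σ (omega w')).card) := by
  intro n
  induction n with
  | zero =>
    intro Q k _ hQ
    have hQ0 : Q = 0 := by
      by_contra h
      obtain ⟨d, hd⟩ := MvPolynomial.ne_zero_iff.mp h
      exact absurd (hQ d (MvPolynomial.mem_support_iff.mpr hd)) (Nat.not_lt_zero _)
    subst hQ0
    rw [map_zero, Ef_zero]; simp
  | succ n ih =>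
    intro Q k hQh hQ
    have hQ' : ∀ s ∈ (pderiv 2 Q).support, s 2 < n := by
      intro s hs
      have := hQ _ (support_pderiv_deg3 hs)
      simp only [Finsupp.add_apply, Finsupp.single_eq_same] at this
      omega
    have ih' := ih (pderiv 2 Q) (k - 1) (isHomogeneous_pderiv3 hQh 2) hQ'
    have hstep := step3 hσ w b w' htop Q k hQh
    have hsp := spec3_le_two hσ w b (aeval w' Q) k hp₀ hp₁ hne
    have hEf : (Ef σ w b (omega w')).card ≤ (Eset σ (omega w')).card :=
      Finset.card_le_card (Ef_subset_Eset σ w b (omega w'))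
    calc (Ef σ w b (aeval w' Q)).card
        ≤ (Spec3 σ w b (aeval w' Q) k p₀ p₁ ∪ Ef σ w b (omega w') ∪ Ef σ w b (aeval w' (pderiv 2 Q))).card :=
          Finset.card_le_card hstep
      _ ≤ (Spec3 σ w b (aeval w' Q) k p₀ p₁).card + (Ef σ w b (omega w')).card +
            (Ef σ w b (aeval w' (pderiv 2 Q))).card := by
          refine (Finset.card_union_le _ _).trans (Nat.add_le_add_right ?_ _)
          exact Finset.card_union_le _ _
      _ ≤ (n + 1) * (2 + (Eset σ (omega w')).card) := by nlinarith [hsp, ih', hEf]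

end ArcTower

end Summit.ValiantsHypothesis.ValiantsHypothesis.Theorems.TwoProducts.RankTwoJacobian

end
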